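import Summits.Ventures.LatticeQCDFlow.Exactness.ReversibleComparison
import Summits.Ventures.LatticeQCDFlow.Exactness.RandomisedHMC
import HarnessLib

/-!
# Randomised trajectory lengths inherit the best length up to its weight: `τ̄_int + ½ ≤ (τ_int,N + ½)/w_N` for every `N` in the support and every observable

HONEST FRAMING: exact (Metropolis-corrected) sampling algorithms for lattice gauge theory;
figures of merit are autocorrelation/cost numbers at stated couplings and volumes; no
continuum-physics claim.  (SCALAR calibration rung S0-A: not a gauge result.)

Venture `LatticeQCDFlow` (cell pub-lqcd), topic `Exactness`; FANOUT row 2 (`s0-phi4`, HMC arm).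
NEW WORK of the cell: the first lattice instance of the comparison theorem
`Exactness/ReversibleComparison.lean` (Peskun–Tierney / Caracciolo–Pelissetto–Sokal in Abel form,
named only there), for row 2's randomised HMC update `Exactness/RandomisedHMC.lean`
(`K̄ = hmcOpRandom J λ δ S w = Σ_{N∈S} w_N K_N`, `K_N = hmcOpPhi4 J λ δ N`: refresh, `N` qpq leapfrog
steps, flip, Metropolis test; Mackenzie 1989 named only there).  Nothing is cited as a fact.

## What is proved (lattice φ⁴ on `V = n+1` sites, `S = ΣφJφ + λΣφ⁴` coercive — every `λ > 0` and
## real `J`; `PolyObs` observables; weights `w_N ≥ 0`, `Σ_{N∈S} w_N = 1`)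

* **`hmcOpRandom_dirichlet_eq`** — the Dirichlet form of the randomised update is the `w`-AVERAGE
  of the components': `𝓔̄(v) = Σ_{N∈S} w_N 𝓔_N(v)` for every `v ∈ PolyObs`;
* **`hmcOpPhi4_dirichlet_le_randomised`** — hence for every `N₀ ∈ S` with `w_{N₀} > 0`:
  `𝓔_{N₀}(v) ≤ w_{N₀}⁻¹ · 𝓔̄(v)` (each `𝓔_N ≥ 0`);
* **`hmcRandom_abelSum_le`** — COMPARISON, ABEL FORM (unconditional): for every `g ∈ PolyObs`,
  `0 ≤ r < 1`, `s = r w_{N₀}⁻¹/(1 − r + r w_{N₀}⁻¹)`: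
  `Σ_k C̄_g(k) sᵏ ≤ (1 − r + r/w_{N₀}) · Σ_k C_{g,N₀}(k) rᵏ`;
* **`hmcRandom_tauInt_add_half_le`** — under the tree's standing summability hypothesis for both
  chains (`g = f − ⟨f⟩`, `Var f > 0`):  **`τ̄_int(f) + ½ ≤ (τ_int,N₀(f) + ½) / w_{N₀}`** for EVERY
  `N₀ ∈ S` — the randomised sampler is never slower, in `τ + ½`, than its best component divided by
  that component's weight, observable by observable (the magnetisation and the action included).

Reading (no numerics implied).  `FreeFieldRandomisedHMCCSD` (gen-15) showed what randomisation does
NOT cure (at fixed mean squared length, `z ≥ 2`); this file is the positive half: mixing lengths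
cannot HURT any observable by more than the inverse weight of the length that serves it best — the
quantitative content of "randomise to be safe against resonances" (a resonant length freezes a
mode, gen-15 `FreeFieldHMCResonance`; any non-resonant length in the support with weight `w`
restores `τ + ½ ≤ (τ_good + ½)/w` for that mode).  NOT CLAIMED: a lower bound on `τ̄` by the
components (the mixture can be strictly faster than every component); state-dependent length laws;
any number for any run.
-/

namespace Summit.Ventures.LatticeQCDFlow.Exactness

open Real MeasureTheory Filter Finset
open Summit.Ventures.LatticeQCDFlow.Scoring

section Random

variable {n : ℕ}

/-- **The Dirichlet form of the randomised update is the weighted average of the components'.** -/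
theorem hmcOpRandom_dirichlet_eq {J : Fin (n + 1) → Fin (n + 1) → ℝ} {lam ε K : ℝ} (hε : 0 < ε)
    (hS : ∀ φ : Fin (n + 1) → ℝ, ε * ∑ x, φ x ^ 2 - K ≤ latticePhi4Action J lam φ)
    (δ : ℝ) {S : Finset ℕ} {w : ℕ → ℝ} (hw1 : ∑ N ∈ S, w N = 1)
    {v : (Fin (n + 1) → ℝ) → ℝ} (hv : PolyObs v) :
    (∫ φ, v φ ^ 2 * gibbsWeight J lam φ) - ∫ φ, v φ * hmcOpRandom J lam δ S w v φ * gibbsWeight J lam φ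
      = ∑ N ∈ S, w N * ((∫ φ, v φ ^ 2 * gibbsWeight J lam φ)
          - ∫ φ, v φ * hmcOpPhi4 J lam δ N v φ * gibbsWeight J lam φ) := by
  have hKv : ∀ N, PolyObs (hmcOpPhi4 J lam δ N v) := fun N => by
    obtain ⟨C, hC1, hCg⟩ := hmcProposal_growth J lam δ N
    exact polyObs_hmcOpOf J lam (measurable_hmcProposal J lam δ N) (zero_le_one.trans hC1) hCg hv
  have hI : ∀ N ∈ S, Integrable
      (fun φ => v φ * (w N * hmcOpPhi4 J lam δ N v φ) * gibbsWeight J lam φ) :=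
    fun N _ => ((polyObs_integrable_mul_mul_gibbsWeight hε hS hv (hKv N)).const_mul (w N)).congr
      (Eventually.of_forall fun φ => by ring)
  have h1 : ∫ φ, v φ * hmcOpRandom J lam δ S w v φ * gibbsWeight J lam φ
      = ∑ N ∈ S, w N * ∫ φ, v φ * hmcOpPhi4 J lam δ N v φ * gibbsWeight J lam φ := by
    unfold hmcOpRandom
    simp_rw [Finset.mul_sum, Finset.sum_mul]
    rw [integral_finsetSum S hI]
    refine Finset.sum_congr rfl fun N _ => ?_
    rw [← integral_const_mul]
    exact integral_congr_ae (Eventually.of_forall fun φ => by ring)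
  rw [h1]
  have h3 : ∑ N ∈ S, w N * ((∫ φ, v φ ^ 2 * gibbsWeight J lam φ)
        - ∫ φ, v φ * hmcOpPhi4 J lam δ N v φ * gibbsWeight J lam φ)
      = (∑ N ∈ S, w N) * (∫ φ, v φ ^ 2 * gibbsWeight J lam φ)
        - ∑ N ∈ S, w N * ∫ φ, v φ * hmcOpPhi4 J lam δ N v φ * gibbsWeight J lam φ := by
    rw [Finset.sum_mul, ← Finset.sum_sub_distrib]
    exact Finset.sum_congr rfl fun N _ => by ring
  rw [h3, hw1, one_mul]

/-- **Each component is dominated by the mixture**: for `N₀ ∈ S` with `w_{N₀} > 0` and every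
`v ∈ PolyObs`, `𝓔_{N₀}(v) ≤ w_{N₀}⁻¹ · 𝓔̄(v)` (every `𝓔_N(v) ≥ 0`). -/
theorem hmcOpPhi4_dirichlet_le_randomised {J : Fin (n + 1) → Fin (n + 1) → ℝ} {lam ε K : ℝ}
    (hε : 0 < ε) (hS : ∀ φ : Fin (n + 1) → ℝ, ε * ∑ x, φ x ^ 2 - K ≤ latticePhi4Action J lam φ)
    (δ : ℝ) {S : Finset ℕ} {w : ℕ → ℝ} (hw0 : ∀ N, 0 ≤ w N) (hw1 : ∑ N ∈ S, w N = 1)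
    {N₀ : ℕ} (hN₀ : N₀ ∈ S) (hwN : 0 < w N₀)
    {v : (Fin (n + 1) → ℝ) → ℝ} (hv : PolyObs v) :
    (∫ φ, v φ ^ 2 * gibbsWeight J lam φ) - ∫ φ, v φ * hmcOpPhi4 J lam δ N₀ v φ * gibbsWeight J lam φ
      ≤ (1 / w N₀) * ((∫ φ, v φ ^ 2 * gibbsWeight J lam φ)
          - ∫ φ, v φ * hmcOpRandom J lam δ S w v φ * gibbsWeight J lam φ) := by
  rw [hmcOpRandom_dirichlet_eq hε hS δ hw1 hv]
  -- every summand is nonnegative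
  have hnn : ∀ N ∈ S, 0 ≤ w N * ((∫ φ, v φ ^ 2 * gibbsWeight J lam φ)
      - ∫ φ, v φ * hmcOpPhi4 J lam δ N v φ * gibbsWeight J lam φ) := by
    intro N _
    obtain ⟨C, hC1, hCg⟩ := hmcProposal_growth J lam δ N
    have hΨm := measurable_hmcProposal (Λ := Fin (n + 1)) J lam δ N
    have hΨi := hmcProposal_involutive (Λ := Fin (n + 1)) J lam δ N
    have hΨμ := measurePreserving_hmcProposal (Λ := Fin (n + 1)) J lam δ N
    have hq := RevOp.quadForm_nonneg (μ := volume) (A := PolyObs)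
      (K := hmcOpOf J lam (hmcProposal J lam δ N)) (w := gibbsWeight J lam)
      (fun φ => (gibbsWeight_pos J lam φ).le)
      (fun f h hf hh => polyObs_integrable_mul_mul_gibbsWeight hε hS hf hh)
      (fun f hf => polyObs_hmcOpOf J lam hΨm (zero_le_one.trans hC1) hCg hf)
      (fun f hf => hmcOpOf_contraction_poly hε hS hΨm hΨi hΨμ (zero_le_one.trans hC1) hCg hf)
      hv zero_le_one le_rfl
    rw [one_mul] at hq
    exact mul_nonneg (hw0 N) hq
  have hle := Finset.single_le_sum hnn hN₀
  set E₀ := (∫ φ, v φ ^ 2 * gibbsWeight J lam φ)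
      - ∫ φ, v φ * hmcOpPhi4 J lam δ N₀ v φ * gibbsWeight J lam φ with hE₀
  calc E₀ = (1 / w N₀) * (w N₀ * E₀) := by field_simp
    _ ≤ (1 / w N₀) * ∑ N ∈ S, w N * ((∫ φ, v φ ^ 2 * gibbsWeight J lam φ)
          - ∫ φ, v φ * hmcOpPhi4 J lam δ N v φ * gibbsWeight J lam φ) :=
        mul_le_mul_of_nonneg_left hle (by positivity)

/-- **COMPARISON, ABEL FORM (unconditional)**: for every `g ∈ PolyObs`, `0 ≤ r < 1`, `N₀ ∈ S` with
`w_{N₀} > 0`, and `s = r w_{N₀}⁻¹/(1 − r + r w_{N₀}⁻¹)`: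
`Σ_k C̄_g(k) sᵏ ≤ (1 − r + r/w_{N₀}) · Σ_k C_{g,N₀}(k) rᵏ`
(`C̄_g(k) = ∫ g (K̄ᵏ g) e^{−S}`, `C_{g,N₀}(k) = ∫ g (K_{N₀}ᵏ g) e^{−S}`). -/
theorem hmcRandom_abelSum_le {J : Fin (n + 1) → Fin (n + 1) → ℝ} {lam ε K : ℝ}
    (hε : 0 < ε) (hS : ∀ φ : Fin (n + 1) → ℝ, ε * ∑ x, φ x ^ 2 - K ≤ latticePhi4Action J lam φ)
    (δ : ℝ) {S : Finset ℕ} {w : ℕ → ℝ} (hw0 : ∀ N, 0 ≤ w N) (hw1 : ∑ N ∈ S, w N = 1)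
    {N₀ : ℕ} (hN₀ : N₀ ∈ S) (hwN : 0 < w N₀)
    {g : (Fin (n + 1) → ℝ) → ℝ} (hg : PolyObs g) {r : ℝ} (hr0 : 0 ≤ r) (hr1 : r < 1) :
    ∑' k, (∫ φ, g φ * ((hmcOpRandom J lam δ S w)^[k] g) φ * gibbsWeight J lam φ)
        * (r * (1 / w N₀) / (1 - r + r * (1 / w N₀))) ^ k
      ≤ (1 - r + r * (1 / w N₀))
        * ∑' k, (∫ φ, g φ * ((hmcOpPhi4 J lam δ N₀)^[k] g) φ * gibbsWeight J lam φ) * r ^ k := by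
  obtain ⟨C, hC1, hCg⟩ := hmcProposal_growth J lam δ N₀
  have hC : 0 ≤ C := zero_le_one.trans hC1
  have hΨm := measurable_hmcProposal (Λ := Fin (n + 1)) J lam δ N₀
  have hΨi := hmcProposal_involutive (Λ := Fin (n + 1)) J lam δ N₀
  have hΨμ := measurePreserving_hmcProposal (Λ := Fin (n + 1)) J lam δ N₀
  exact RevOp.abelSum_le_of_dirichlet_le_mul (μ := volume) (A := PolyObs)
    (K := hmcOpOf J lam (hmcProposal J lam δ N₀)) (K' := hmcOpRandom J lam δ S w)
    (w := gibbsWeight J lam)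
    (fun φ => (gibbsWeight_pos J lam φ).le)
    (fun f h hf hh => polyObs_integrable_mul_mul_gibbsWeight hε hS hf hh)
    (fun f h c hf hh => polyObs_add_mul hf hh c)
    (fun f hf => polyObs_hmcOpOf J lam hΨm hC hCg hf)
    (fun f h c hf hh x => hmcOpOf_add_mul_poly J lam hΨm hC hCg hf hh c x)
    (fun f h hf hh => hmc_reversible_poly hε hS hΨm hΨi hΨμ hf hh)
    (fun f hf => hmcOpOf_contraction_poly hε hS hΨm hΨi hΨμ hC hCg hf)
    (fun f hf => polyObs_hmcOpRandom J lam δ S w hf)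
    (fun f h c hf hh x => hmcOpRandom_add_mul J lam δ S w hf hh c x)
    (fun f h hf hh => hmcOpRandom_reversible hε hS δ S w hf hh)
    (fun f hf => hmcOpRandom_contraction hε hS δ hw0 hw1 hf)
    (one_div_pos.2 hwN)
    (fun v hv => hmcOpPhi4_dirichlet_le_randomised hε hS δ hw0 hw1 hN₀ hwN hv) hg hr0 hr1

/-- **RANDOMISED TRAJECTORY LENGTHS INHERIT THE BEST LENGTH UP TO ITS WEIGHT.**  Lattice φ⁴ with a
coercive action (every `λ > 0`, real `J`), row 2's HMC `K_N = hmcOpPhi4 J λ δ N` and its randomised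
version `K̄ = Σ_{N∈S} w_N K_N` (`w_N ≥ 0`, `Σ w_N = 1`); `f ∈ PolyObs` (the magnetisation, the action,
…) with `Var f > 0`, `g = f − ⟨f⟩`, and summable normalised autocorrelation series under both `K̄` and
`K_{N₀}` (the tree's standing hypothesis).  Then for every `N₀ ∈ S` with `w_{N₀} > 0`:
`τ̄_int(f) + ½ ≤ (τ_int,N₀(f) + ½) / w_{N₀}`. -/
theorem hmcRandom_tauInt_add_half_le {J : Fin (n + 1) → Fin (n + 1) → ℝ} {lam ε K : ℝ}
    (hε : 0 < ε) (hS : ∀ φ : Fin (n + 1) → ℝ, ε * ∑ x, φ x ^ 2 - K ≤ latticePhi4Action J lam φ)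
    (δ : ℝ) {S : Finset ℕ} {w : ℕ → ℝ} (hw0 : ∀ N, 0 ≤ w N) (hw1 : ∑ N ∈ S, w N = 1)
    {N₀ : ℕ} (hN₀ : N₀ ∈ S) (hwN : 0 < w N₀)
    {f : (Fin (n + 1) → ℝ) → ℝ} (hf : PolyObs f)
    (hP : 0 < ∫ φ, (f φ - gibbsExpect J lam f) ^ 2 * gibbsWeight J lam φ)
    (hsN : Summable fun k => (∫ φ, (f φ - gibbsExpect J lam f)
        * ((hmcOpPhi4 J lam δ N₀)^[k + 1] (fun ψ => f ψ - gibbsExpect J lam f)) φ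
        * gibbsWeight J lam φ)
        / ∫ φ, (f φ - gibbsExpect J lam f) ^ 2 * gibbsWeight J lam φ)
    (hsR : Summable fun k => (∫ φ, (f φ - gibbsExpect J lam f)
        * ((hmcOpRandom J lam δ S w)^[k + 1] (fun ψ => f ψ - gibbsExpect J lam f)) φ
        * gibbsWeight J lam φ)
        / ∫ φ, (f φ - gibbsExpect J lam f) ^ 2 * gibbsWeight J lam φ) :
    tauInt (fun k => (∫ φ, (f φ - gibbsExpect J lam f)
          * ((hmcOpRandom J lam δ S w)^[k] (fun ψ => f ψ - gibbsExpect J lam f)) φ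
          * gibbsWeight J lam φ)
          / ∫ φ, (f φ - gibbsExpect J lam f) ^ 2 * gibbsWeight J lam φ) + 1 / 2
      ≤ (1 / w N₀) * (tauInt (fun k => (∫ φ, (f φ - gibbsExpect J lam f)
          * ((hmcOpPhi4 J lam δ N₀)^[k] (fun ψ => f ψ - gibbsExpect J lam f)) φ
          * gibbsWeight J lam φ)
          / ∫ φ, (f φ - gibbsExpect J lam f) ^ 2 * gibbsWeight J lam φ) + 1 / 2) := by
  have hg : PolyObs (fun ψ => f ψ - gibbsExpect J lam f) := polyObs_sub_const hf _
  obtain ⟨C, hC1, hCg⟩ := hmcProposal_growth J lam δ N₀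
  have hC : 0 ≤ C := zero_le_one.trans hC1
  have hΨm := measurable_hmcProposal (Λ := Fin (n + 1)) J lam δ N₀
  have hΨi := hmcProposal_involutive (Λ := Fin (n + 1)) J lam δ N₀
  have hΨμ := measurePreserving_hmcProposal (Λ := Fin (n + 1)) J lam δ N₀
  exact RevOp.tauInt_add_half_le_of_dirichlet_le_mul (μ := volume) (A := PolyObs)
    (K := hmcOpOf J lam (hmcProposal J lam δ N₀)) (K' := hmcOpRandom J lam δ S w)
    (w := gibbsWeight J lam)
    (fun φ => (gibbsWeight_pos J lam φ).le)
    (fun f h hf hh => polyObs_integrable_mul_mul_gibbsWeight hε hS hf hh)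
    (fun f h c hf hh => polyObs_add_mul hf hh c)
    (fun f hf => polyObs_hmcOpOf J lam hΨm hC hCg hf)
    (fun f h c hf hh x => hmcOpOf_add_mul_poly J lam hΨm hC hCg hf hh c x)
    (fun f h hf hh => hmc_reversible_poly hε hS hΨm hΨi hΨμ hf hh)
    (fun f hf => hmcOpOf_contraction_poly hε hS hΨm hΨi hΨμ hC hCg hf)
    (fun f hf => polyObs_hmcOpRandom J lam δ S w hf)
    (fun f h c hf hh x => hmcOpRandom_add_mul J lam δ S w hf hh c x)
    (fun f h hf hh => hmcOpRandom_reversible hε hS δ S w hf hh)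
    (one_div_pos.2 hwN)
    (fun v hv => hmcOpPhi4_dirichlet_le_randomised hε hS δ hw0 hw1 hN₀ hwN hv) hg hP hsN hsR

/-- The same for `λ > 0` and real `J` (coercivity supplied by `latticePhi4Action_coercive`), `c = w⁻¹`
written as a quotient: `τ̄_int(f) + ½ ≤ (τ_int,N₀(f) + ½) / w_{N₀}`. -/
theorem hmcRandom_tauInt_add_half_le' {lam : ℝ} (hlam : 0 < lam) (J : Fin (n + 1) → Fin (n + 1) → ℝ)
    (δ : ℝ) {S : Finset ℕ} {w : ℕ → ℝ} (hw0 : ∀ N, 0 ≤ w N) (hw1 : ∑ N ∈ S, w N = 1)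
    {N₀ : ℕ} (hN₀ : N₀ ∈ S) (hwN : 0 < w N₀)
    {f : (Fin (n + 1) → ℝ) → ℝ} (hf : PolyObs f)
    (hP : 0 < ∫ φ, (f φ - gibbsExpect J lam f) ^ 2 * gibbsWeight J lam φ)
    (hsN : Summable fun k => (∫ φ, (f φ - gibbsExpect J lam f)
        * ((hmcOpPhi4 J lam δ N₀)^[k + 1] (fun ψ => f ψ - gibbsExpect J lam f)) φ
        * gibbsWeight J lam φ)
        / ∫ φ, (f φ - gibbsExpect J lam f) ^ 2 * gibbsWeight J lam φ)
    (hsR : Summable fun k => (∫ φ, (f φ - gibbsExpect J lam f)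
        * ((hmcOpRandom J lam δ S w)^[k + 1] (fun ψ => f ψ - gibbsExpect J lam f)) φ
        * gibbsWeight J lam φ)
        / ∫ φ, (f φ - gibbsExpect J lam f) ^ 2 * gibbsWeight J lam φ) :
    tauInt (fun k => (∫ φ, (f φ - gibbsExpect J lam f)
          * ((hmcOpRandom J lam δ S w)^[k] (fun ψ => f ψ - gibbsExpect J lam f)) φ
          * gibbsWeight J lam φ)
          / ∫ φ, (f φ - gibbsExpect J lam f) ^ 2 * gibbsWeight J lam φ) + 1 / 2
      ≤ (tauInt (fun k => (∫ φ, (f φ - gibbsExpect J lam f)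
          * ((hmcOpPhi4 J lam δ N₀)^[k] (fun ψ => f ψ - gibbsExpect J lam f)) φ
          * gibbsWeight J lam φ)
          / ∫ φ, (f φ - gibbsExpect J lam f) ^ 2 * gibbsWeight J lam φ) + 1 / 2) / w N₀ := by
  have hco := latticePhi4Action_coercive hlam J
  have h := hmcRandom_tauInt_add_half_le one_pos hco δ hw0 hw1 hN₀ hwN hf hP hsN hsR
  have e : ∀ x : ℝ, x / w N₀ = (1 / w N₀) * x := fun x => by ring
  rw [e]
  exact h

end Random

end Summit.Ventures.LatticeQCDFlow.Exactness
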